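import Mathlib
import Summits.KontsevichZagierPeriods.KontsevichZagierPeriods.Theorems.SoloInformedKappaKills
import Literature.NumberTheory.Transcendental.CurvePeriodsStokesProofs
import HarnessLib

/-!
# Solo-informed: concatenation invariance (HT) of `κ̃`, constant paths, and (HT) ⇒ (HI)

File J5a of the `κ`-side of Rung 2 (`paper/rung2-v2.md` §4.5, §5 (R5)). The single topological
input which the Stokes-grid argument (file I) delivers is best phrased for CONCATENATIONS:

* `SoloInformedHomotopicConcat a b d` — the `C¹` paths `a, b, d` on `Z` agree on `[0,1]` with
  continuous paths `pa : x ⟶ y`, `pb : y ⟶ z`, `pd : x ⟶ z` in `Z(ℂ)` with `pa · pb ~ pd` rel end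
  points;
* `SoloInformedNashHT` — **(HT)**: for Nash paths `a, b, d` with `a · b ~ d`,
  `κ̃(Z, ω, a) + κ̃(Z, ω, b) = κ̃(Z, ω, d)`;
* `soloInformed_isNashPath_const`, `soloInformedKappaTilde_const` — the constant path at an
  algebraic point is Nash and has `κ̃ = 0` (its integrand vanishes);
* `soloInformed_nashHI_of_HT` — **(HT) ⇒ (HI)** (`γ ~ γ′` gives `γ · const ~ γ′`);
* `soloInformed_volumeRung_two_of_HT` — Rung 2 from (HW), (APPROX), (HT) and (R5) for `κ`.

(R5) for `κ` from (HT) — the triangle `τ` makes `e₀₁ · e₁₂ ~ e₀₂`, and the Nash replacements are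
homotopic to the edges — is file J5b.

References: Huber–Wüstholz, *Transcendence and linear relations of 1-periods* (2022), §7.2, §13.1.
-/

noncomputable section

open scoped unitInterval
open MeasureTheory Set MvPolynomial
open Literature.NumberTheory.Transcendental Literature.NumberTheory.Transcendental.KZ
open Literature.NumberTheory.Transcendental.CurvePeriods
open Literature.ModelTheory.ExponentialFields

namespace Summit.KontsevichZagierPeriods.KontsevichZagierPeriods.Theorems

/-! ## 1. `κ̃` of a symbol with vanishing integrand; constant paths -/

/-- `κ̃ = 0` when the path integrand vanishes on `[0,1]`. -/
theorem soloInformedKappaTilde_eq_zero_of_integrand (s : PeriodSymbol)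
    (hN : SoloInformedIsNashPath s.γ.toFun)
    (h0 : ∀ t ∈ Icc (0 : ℝ) 1, soloInformedPathIntegrand s t = 0) :
    soloInformedKappaTilde s hN = 0 := by
  have h0' : ∀ x ∈ soloInformedUnitI, soloInformedPathIntegrand s (x 0) = 0 := fun x hx =>
    h0 _ ⟨hx.1, hx.2⟩
  ext
  · rw [soloInformedKappaTilde_fst, SoloInformedV.fst_zero]
    exact toFormalPeriod_eq_zero_of_mem (of_mem_relations_of_eqOn_zero _ fun x hx => by
      simp only [soloInformedPathRepRe_integrand, h0' x hx, Complex.zero_re, Pi.zero_apply])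
  · rw [soloInformedKappaTilde_snd, SoloInformedV.snd_zero]
    exact toFormalPeriod_eq_zero_of_mem (of_mem_relations_of_eqOn_zero _ fun x hx => by
      simp only [soloInformedPathRepIm_integrand, h0' x hx, Complex.zero_im, Pi.zero_apply])

/-- **The constant path at an algebraic point is a Nash path.** -/
theorem soloInformed_isNashPath_const {Z : CurveData} (p : Fin Z.n → ℂ) (hp : p ∈ Z.points)
    (ha : ∀ i, IsAlgebraic ℚ (p i)) : SoloInformedIsNashPath (CurvePath.const p hp ha).toFun := by
  suffices H : ∀ ε : ℚ, 0 < ε → SoloInformedIsNashPath (CurvePath.const p hp ha).toFun from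
    H 1 one_pos
  intro ε hε
  have hs := isSemialgebraic_soloInformedIoo1 (-ε) (1 + ε)
  push_cast at hs
  exact ⟨ε, hε, contDiffOn_const, fun i => SoloInformedReImSA.const hs (ha i)⟩

/-- The path integrand of a constant path vanishes. -/
theorem soloInformedPathIntegrand_const (Z : CurveData) (hZ : Z.IsSmoothAffineCurve)
    (ω : Fin Z.n → MvPolynomial (Fin Z.n) ℂ) (hω : ∀ i, HasAlgCoeffs (ω i)) (p : Fin Z.n → ℂ)
    (hp : p ∈ Z.points) (ha : ∀ i, IsAlgebraic ℚ (p i)) (t : ℝ) :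
    soloInformedPathIntegrand ⟨Z, hZ, ω, hω, CurvePath.const p hp ha⟩ t = 0 := by
  show ∑ i, eval p (ω i) * deriv (fun _ : ℝ => p i) t = 0
  simp

/-- **`κ̃(Z, ω, const) = 0`.** -/
theorem soloInformedKappaTilde_const (Z : CurveData) (hZ : Z.IsSmoothAffineCurve)
    (ω : Fin Z.n → MvPolynomial (Fin Z.n) ℂ) (hω : ∀ i, HasAlgCoeffs (ω i)) (p : Fin Z.n → ℂ)
    (hp : p ∈ Z.points) (ha : ∀ i, IsAlgebraic ℚ (p i))
    (hN : SoloInformedIsNashPath (CurvePath.const p hp ha).toFun) :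
    soloInformedKappaTilde ⟨Z, hZ, ω, hω, CurvePath.const p hp ha⟩ hN = 0 :=
  soloInformedKappaTilde_eq_zero_of_integrand _ hN fun t _ =>
    soloInformedPathIntegrand_const Z hZ ω hω p hp ha t

/-! ## 2. Concatenation up to homotopy and (HT) -/

/-- **`a · b ~ d`**: the `C¹` paths `a, b, d` on `Z` agree on `[0, 1]` with continuous paths
`pa : x ⟶ y`, `pb : y ⟶ z`, `pd : x ⟶ z` in `Z(ℂ)` such that the concatenation `pa · pb` is
homotopic to `pd` with fixed end points. [Huber–Wüstholz 2022, §3.3.1] -/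
def SoloInformedHomotopicConcat {Z : CurveData} (a b d : CurvePath Z) : Prop :=
  ∃ (x y z : Z.points) (pa : Path x y) (pb : Path y z) (pd : Path x z),
    (∀ t : I, a.toFun t = pa t) ∧ (∀ t : I, b.toFun t = pb t) ∧ (∀ t : I, d.toFun t = pd t) ∧
      (pa.trans pb).Homotopic pd

/-- **(HT)** — invariance of `κ̃` under concatenation up to homotopy: for Nash paths `a, b, d` on a
smooth affine curve with `a · b ~ d` rel end points, `κ̃(Z, ω, a) + κ̃(Z, ω, b) = κ̃(Z, ω, d)`.
(To be proved by the Stokes-grid argument, file I.) [Huber–Wüstholz 2022, §7.2 with §13.1] -/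
def SoloInformedNashHT : Prop :=
  ∀ (Z : CurveData) (hZ : Z.IsSmoothAffineCurve) (ω : Fin Z.n → MvPolynomial (Fin Z.n) ℂ)
    (hω : ∀ i, HasAlgCoeffs (ω i)) (a b d : CurvePath Z) (ha : SoloInformedIsNashPath a.toFun)
    (hb : SoloInformedIsNashPath b.toFun) (hd : SoloInformedIsNashPath d.toFun),
    SoloInformedHomotopicConcat a b d →
      soloInformedKappaTilde ⟨Z, hZ, ω, hω, a⟩ ha + soloInformedKappaTilde ⟨Z, hZ, ω, hω, b⟩ hb =
        soloInformedKappaTilde ⟨Z, hZ, ω, hω, d⟩ hd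

/-- `γ ~ γ′` gives `γ · const ~ γ′` (the constant path at the common end point). -/
theorem SoloInformedHomotopic.concat_const {Z : CurveData} {γ γ' : CurvePath Z}
    (h : SoloInformedHomotopic γ γ') :
    SoloInformedHomotopicConcat γ
      (CurvePath.const (γ.toFun 1) (γ.mem_points 1 ⟨zero_le_one, le_rfl⟩) γ.algebraic_one) γ' := by
  obtain ⟨x, y, p₀, p₁, h₀, h₁, hp⟩ := h
  have e : γ.toFun 1 = (y : Fin Z.n → ℂ) := by
    have := h₀ 1
    simp only [Set.Icc.coe_one, Path.target] at this
    exact this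
  exact ⟨x, y, y, p₀, Path.refl y, p₁, h₀, fun _ => e, h₁, (Path.Homotopic.trans_refl p₀).trans hp⟩

/-! ## 3. (HT) ⇒ (HI) -/

/-- **(HT) ⇒ (HI).** -/
theorem soloInformed_nashHI_of_HT (hT : SoloInformedNashHT) : SoloInformedNashHI := by
  intro Z hZ ω hω γ γ' h h' hhom
  have hc := soloInformed_isNashPath_const (γ.toFun 1) (γ.mem_points 1 ⟨zero_le_one, le_rfl⟩)
    γ.algebraic_one
  have := hT Z hZ ω hω γ _ γ' h hc h' hhom.concat_const
  rwa [soloInformedKappaTilde_const, add_zero] at this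

/-- **Rung 2 from (HW), (APPROX), (HT) and (R5) for `κ`.** -/
theorem soloInformed_volumeRung_two_of_HT (hA : SoloInformedNashApprox) (hT : SoloInformedNashHT)
    (h5 : SoloInformedKappaR5 hA) (hHW : HuberWustholzCurvePeriods) : SoloInformedVolumeRung 2 :=
  soloInformed_volumeRung_two_of_nash' hA (soloInformed_nashHI_of_HT hT) h5 hHW

end Summit.KontsevichZagierPeriods.KontsevichZagierPeriods.Theorems

/-!
# Solo-informed: (R5) for `κ` from (HT) — boundaries of triangles

File J5b of the `κ`-side of Rung 2 (`paper/rung2-v2.md` §5 (R5)). The standing proposition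
`SoloInformedKappaR5 hA` of `SoloInformedKappaKills.lean` is a THEOREM under (APPROX) and (HT):

* `SoloInformedHomotopicConcat.congr` — `a · b ~ d` is stable under replacing `a, b, d` by
  homotopic paths (in particular by their Nash replacements);
* `soloInformed_homotopicConcat_of_triangle` — for a continuous map `τ : Δ → Z(ℂ)` of the standard
  triangle whose edges agree with `C¹` paths `e₀₁, e₁₂, e₀₂` one has `e₀₁ · e₁₂ ~ e₀₂`: the two
  parameter paths in the convex (hence simply connected) triangle are homotopic
  (`SimplyConnectedSpace.paths_homotopic`) and `τ` maps the homotopy into `Z(ℂ)`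
  (`Path.Homotopic.map`);
* `soloInformed_kappaR5 : (HT) → SoloInformedKappaR5 hA`;
* `soloInformed_volumeRung_two_of_HT'` — **Rung 2 from (HW), (APPROX) and (HT) alone.**

References: Huber–Wüstholz, *Transcendence and linear relations of 1-periods* (2022), §13.1 (A).
-/


open scoped unitInterval
open MeasureTheory Set MvPolynomial
open Literature.NumberTheory.Transcendental Literature.NumberTheory.Transcendental.KZ
open Literature.NumberTheory.Transcendental.CurvePeriods
open Literature.ModelTheory.ExponentialFields

namespace Summit.KontsevichZagierPeriods.KontsevichZagierPeriods.Theorems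

/-! ## 1. Stability of `a · b ~ d` under homotopies -/

/-- Two continuous paths agreeing pointwise (as points of `ℂⁿ`) with the same `C¹` path have the
same end points. -/
theorem soloInformed_path_pt_eq {Z : CurveData} {γ : CurvePath Z} {x y x' y' : Z.points}
    {p : Path x y} {q : Path x' y'} (hp : ∀ t : I, γ.toFun t = p t)
    (hq : ∀ t : I, γ.toFun t = q t) : x = x' ∧ y = y' := by
  have h0 := (hp 0).symm.trans (hq 0)
  have h1 := (hp 1).symm.trans (hq 1)
  simp only [Path.source, Path.target] at h0 h1
  exact ⟨Subtype.ext h0, Subtype.ext h1⟩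

/-- Two continuous paths with the same end points agreeing pointwise with the same `C¹` path are
equal. -/
theorem soloInformed_path_eq {Z : CurveData} {γ : CurvePath Z} {x y : Z.points} {p q : Path x y}
    (hp : ∀ t : I, γ.toFun t = p t) (hq : ∀ t : I, γ.toFun t = q t) : p = q :=
  Path.ext (funext fun t => Subtype.ext ((hp t).symm.trans (hq t)))

/-- **`a · b ~ d` is stable under homotopies of `a`, `b`, `d`.** -/
theorem SoloInformedHomotopicConcat.congr {Z : CurveData} {a b d a' b' d' : CurvePath Z}
    (h : SoloInformedHomotopicConcat a b d) (ha : SoloInformedHomotopic a a')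
    (hb : SoloInformedHomotopic b b') (hd : SoloInformedHomotopic d d') :
    SoloInformedHomotopicConcat a' b' d' := by
  obtain ⟨x, y, z, pa, pb, pd, hpa, hpb, hpd, hh⟩ := h
  obtain ⟨xa, ya, qa₀, qa₁, hqa₀, hqa₁, hqa⟩ := ha
  obtain ⟨xb, yb, qb₀, qb₁, hqb₀, hqb₁, hqb⟩ := hb
  obtain ⟨xd, yd, qd₀, qd₁, hqd₀, hqd₁, hqd⟩ := hd
  obtain ⟨hxa, hya⟩ := soloInformed_path_pt_eq hqa₀ hpa
  obtain ⟨hxb, hyb⟩ := soloInformed_path_pt_eq hqb₀ hpb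
  obtain ⟨hxd, hyd⟩ := soloInformed_path_pt_eq hqd₀ hpd
  subst hxa hya hxb hyb hxd hyd
  have ea : qa₀ = pa := soloInformed_path_eq hqa₀ hpa
  have eb : qb₀ = pb := soloInformed_path_eq hqb₀ hpb
  have ed : qd₀ = pd := soloInformed_path_eq hqd₀ hpd
  subst ea eb ed
  exact ⟨_, _, _, qa₁, qb₁, qd₁, hqa₁, hqb₁, hqd₁,
    ((hqa.symm.hcomp hqb.symm).trans hh).trans hqd⟩

/-! ## 2. The standard triangle is simply connected; its edge paths -/

/-- The vertices `(0,0)`, `(1,0)`, `(0,1)` of the standard triangle. -/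
theorem soloInformed_mem_stdTriangle_v0 : ((0 : ℝ), (0 : ℝ)) ∈ stdTriangle := by
  simp [stdTriangle]

/-- See `soloInformed_mem_stdTriangle_v0`. -/
theorem soloInformed_mem_stdTriangle_v1 : ((1 : ℝ), (0 : ℝ)) ∈ stdTriangle := by
  simp [stdTriangle]

/-- See `soloInformed_mem_stdTriangle_v0`. -/
theorem soloInformed_mem_stdTriangle_v2 : ((0 : ℝ), (1 : ℝ)) ∈ stdTriangle := by
  simp [stdTriangle]

/-- A continuous parameter path `g : [0,1] → Δ`, as a `Path` in the subspace `Δ`. -/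
def soloInformedTriPath (g : ℝ → ℝ × ℝ) (hg : Continuous g)
    (hmem : ∀ t ∈ Icc (0 : ℝ) 1, g t ∈ stdTriangle) :
    Path (⟨g 0, hmem 0 ⟨le_rfl, zero_le_one⟩⟩ : stdTriangle)
      ⟨g 1, hmem 1 ⟨zero_le_one, le_rfl⟩⟩ where
  toFun t := ⟨g t, hmem t t.2⟩
  continuous_toFun := (hg.comp continuous_subtype_val).subtype_mk _
  source' := rfl
  target' := rfl

/-- Values of `soloInformedTriPath` (definitional). -/
@[simp] theorem soloInformedTriPath_apply_coe (g : ℝ → ℝ × ℝ) (hg : Continuous g)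
    (hmem : ∀ t ∈ Icc (0 : ℝ) 1, g t ∈ stdTriangle) (t : I) :
    ((soloInformedTriPath g hg hmem t : stdTriangle) : ℝ × ℝ) = g t := rfl

/-- The edge `t ↦ (t, 0)` lies in `Δ`. -/
theorem soloInformed_edge01_mem (t : ℝ) (ht : t ∈ Icc (0 : ℝ) 1) :
    ((t, (0 : ℝ)) : ℝ × ℝ) ∈ stdTriangle := by
  simp only [stdTriangle, mem_setOf_eq, add_zero]; exact ⟨ht.1, le_rfl, ht.2⟩

/-- The edge `t ↦ (1 - t, t)` lies in `Δ`. -/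
theorem soloInformed_edge12_mem (t : ℝ) (ht : t ∈ Icc (0 : ℝ) 1) :
    ((1 - t, t) : ℝ × ℝ) ∈ stdTriangle := by
  simp only [stdTriangle, mem_setOf_eq, sub_add_cancel]; exact ⟨by linarith [ht.2], ht.1, le_rfl⟩

/-- The edge `t ↦ (0, t)` lies in `Δ`. -/
theorem soloInformed_edge02_mem (t : ℝ) (ht : t ∈ Icc (0 : ℝ) 1) :
    (((0 : ℝ), t) : ℝ × ℝ) ∈ stdTriangle := by
  simp only [stdTriangle, mem_setOf_eq, zero_add]; exact ⟨le_rfl, ht.1, ht.2⟩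

/-! ## 3. `e₀₁ · e₁₂ ~ e₀₂` for the edges of a continuous triangle -/

/-- **The edges of a continuous triangle `τ : Δ → Z(ℂ)` satisfy `e₀₁ · e₁₂ ~ e₀₂`.**
[folklore: a convex set is simply connected] -/
theorem soloInformed_homotopicConcat_of_triangle {Z : CurveData} (τ : ℝ × ℝ → (Fin Z.n → ℂ))
    (hτc : ContinuousOn τ stdTriangle) (hτZ : MapsTo τ stdTriangle Z.points)
    (e₀₁ e₁₂ e₀₂ : CurvePath Z) (h01 : ∀ t ∈ Icc (0 : ℝ) 1, e₀₁.toFun t = τ (t, 0))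
    (h12 : ∀ t ∈ Icc (0 : ℝ) 1, e₁₂.toFun t = τ (1 - t, t))
    (h02 : ∀ t ∈ Icc (0 : ℝ) 1, e₀₂.toFun t = τ (0, t)) :
    SoloInformedHomotopicConcat e₀₁ e₁₂ e₀₂ := by
  haveI : ContractibleSpace stdTriangle :=
    convex_stdTriangle.contractibleSpace ⟨_, soloInformed_mem_stdTriangle_v0⟩
  -- `τ` as a continuous map `Δ → Z(ℂ)`
  let F : C(stdTriangle, Z.points) :=
    ⟨fun p => ⟨τ p, hτZ p.2⟩,
      (hτc.comp_continuous continuous_subtype_val fun p => p.2).subtype_mk _⟩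
  -- the vertices and the edge paths in `Δ`
  let v0 : stdTriangle := ⟨((0 : ℝ), (0 : ℝ)), soloInformed_mem_stdTriangle_v0⟩
  let v1 : stdTriangle := ⟨((1 : ℝ), (0 : ℝ)), soloInformed_mem_stdTriangle_v1⟩
  let v2 : stdTriangle := ⟨((0 : ℝ), (1 : ℝ)), soloInformed_mem_stdTriangle_v2⟩
  let p01 : Path v0 v1 :=
    soloInformedTriPath (fun t => (t, 0)) (by fun_prop) soloInformed_edge01_mem
  let p12 : Path v1 v2 := (soloInformedTriPath (fun t => (1 - t, t)) (by fun_prop)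
    soloInformed_edge12_mem).cast
      (Subtype.ext (show ((1 : ℝ), (0 : ℝ)) = ((1 : ℝ) - 0, (0 : ℝ)) by norm_num))
      (Subtype.ext (show ((0 : ℝ), (1 : ℝ)) = ((1 : ℝ) - 1, (1 : ℝ)) by norm_num))
  let p02 : Path v0 v2 :=
    soloInformedTriPath (fun t => (0, t)) (by fun_prop) soloInformed_edge02_mem
  have hΔ : (p01.trans p12).Homotopic p02 := SimplyConnectedSpace.paths_homotopic _ _
  refine ⟨F v0, F v1, F v2, p01.map F.continuous, p12.map F.continuous, p02.map F.continuous,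
    fun t => ?_, fun t => ?_, fun t => ?_, ?_⟩
  · rw [h01 t t.2]; rfl
  · rw [h12 t t.2]; rfl
  · rw [h02 t t.2]; rfl
  · rw [← Path.map_trans]
    exact hΔ.map F

/-! ## 4. (R5) for `κ` -/

/-- **(R5) for `κ` is a theorem under (APPROX) and (HT).** [Huber–Wüstholz 2022, §13.1 (A);
paper/rung2-v2.md §5] -/
theorem soloInformed_kappaR5 (hA : SoloInformedNashApprox) (hT : SoloInformedNashHT) :
    SoloInformedKappaR5 hA := by
  intro Z hZ ω h τ hτ hτZ e₀₁ e₁₂ e₀₂ h01 h12 h02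
  rw [soloInformedKappa_mk, soloInformedKappa_mk, soloInformedKappa_mk]
  exact hT Z hZ ω h _ _ _ _ _ _
    ((soloInformed_homotopicConcat_of_triangle τ hτ.continuousOn hτZ e₀₁ e₁₂ e₀₂ h01 h12 h02).congr
      (soloInformedNashRepl_homotopic hA hZ e₀₁) (soloInformedNashRepl_homotopic hA hZ e₁₂)
      (soloInformedNashRepl_homotopic hA hZ e₀₂))

/-- **Rung 2 from (HW), (APPROX) and (HT).** The remaining inputs are the Nash approximation of
`C¹` paths (APPROX) and the concatenation/homotopy invariance (HT) of `κ̃` on Nash paths. -/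
theorem soloInformed_volumeRung_two_of_HT' (hA : SoloInformedNashApprox) (hT : SoloInformedNashHT)
    (hHW : HuberWustholzCurvePeriods) : SoloInformedVolumeRung 2 :=
  soloInformed_volumeRung_two_of_HT hA hT (soloInformed_kappaR5 hA hT) hHW

end Summit.KontsevichZagierPeriods.KontsevichZagierPeriods.Theorems
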